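import Summits.NavierStokesRegularity.FunctionalMining.TopEigHeatRate
import Summits.NavierStokesRegularity.FunctionalMining.TopEigGapCoerciveHigh
import Summits.NavierStokesRegularity.FunctionalMining.NoGo.TopEigHeatNoConcentration
import Summits.NavierStokesRegularity.FunctionalMining.NoGo.TopEigHeatVarianceLow
import HarnessLib

/-!
# FunctionalMining / NoGo — K59: the SHAPE OF A KILL for Lemma L-λ(q), every real `q > 1`
# `¬ TopEigHeatCoercivePos q ↔` a killing sequence exists; every killing sequence FILLS the torus,
# FLATTENS (`Φ_{q/2}²/Φ_q → 1`), is AMPLITUDE-FLAT (`q(q−1)∫λ₁^{q−2}|∇λ₁|² / Φ_q → 0`) and, for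
# `q ≥ 2`, LEAVES EVERY TOP-GAP CLASS (near-biaxial points `λ₂ > (1−η)λ₁` eventually, every `η > 0`)

HONEST FRAMING. Search for candidate a priori estimates; no regularity claim. Nothing about
Navier–Stokes is proved or asserted in this file. Cell `pub-nsfunc`, no-go seat (gen 53, touch 5).
Static calculus of smooth fields on the flat torus; no node of the cell is decided here — Lemma
L-λ(q) = `TopEig.TopEigHeatCoercivePos q` stays OPEN in the kernel for every real `q > 1`.

CONTEXT. Door (b)/(F2) of `NOGO.md` is the WANTED kernel negation `¬ TopEigHeatCoercivePos q`
(`Φ_q = torusTopEigMoment q = ∫ (λ₁⁺)^q`, `λ₁ = torusStrainTopEig v`, price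
`heatDissipation Φ_q v`).
The design rules (R12) flattening / (R12′) no concentration of `sieveld/DOOR-E-SPEC.md` were
kernelised for real `q ≥ 2` (K53b `NoGo/TopEigHeatVariance`, K53c
`NoGo/TopEigHeatNoConcentration`) and (R12) for every real `q > 1` (K58
`NoGo/TopEigHeatVarianceLow`); the amplitude floor LEMMA AF
holds for every real `q > 1` (K57a `NoGo/TopEigAmplitudeFloorLow`). This file states the rules ON
THE NODE ITSELF, in sequential form, for every real `q > 1`.

CONTENT.
* § 1 (real `q ≥ 1`). **`not_coercivePos_iff_exists_seq`**: `¬ TopEigHeatCoercivePos q ↔` there is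
  a KILLING SEQUENCE — smooth, divergence-free, zero-mean fields `v n` on `T³` with `Φ_q(v n) > 0`
  and `heatDissipation Φ_q (v n) / Φ_q(v n) → 0` (heat sieve `topEigHeatCoercive_zero` for
  `Φ_q(v n) > 0`; `choose` at the rates `1/(n+1)`); `topEigHeatRate_eq_zero_iff_exists_seq`.
* § 2 (real `q > 1`, `T³`). (R12′) for every real `q > 1`:
  **`one_sub_measureReal_mul_moment_le_heatDissipation_of_one_lt`**
  `16π²(q−1)/q · (1 − vol A) · Φ_q ≤ heatDissipation Φ_q v` whenever `λ₁ ≤ 0` off `A`, the sparse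
  price and the filling bound `1 − q/(16π²(q−1)) · heatDissipation Φ_q v / Φ_q ≤ vol{λ₁ > 0}`
  (K58ʼs rate–moments rule for `q > 1` + K53cʼs Cauchy–Schwarz § 1).
* § 3 (real `q > 1`, `T³`). Along EVERY killing sequence: **`tendsto_measureReal_pos_of_killing`**
  `vol{λ₁(v n) > 0} → 1`, **`tendsto_moment_ratio_of_killing`** `Φ_{q/2}(v n)²/Φ_q(v n) → 1`,
  **`tendsto_amplitude_div_of_killing`** `q(q−1)∫λ₁^{q−2}Σᵢ(∂ᵢλ₁)² / Φ_q(v n) → 0`; assembled on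
  the node as **`killing_shape_of_not_coercivePos`**: `¬ TopEigHeatCoercivePos q →` such a sequence
  with all three limits exists.
* § 4 (real `q ≥ 2`, `T³`). **`eventually_not_strainGapClass_of_killing`**: a killing sequence is
  eventually OUTSIDE every top-gap class `λ₂ ≤ (1−η)λ₁`, `η > 0` (sequential form of the treeʼs
  Proposition L-λ(η) `topEigGapCoercivePos_of_ge_two` / `violators_outside_every_gap_of_not_pos…`):
  eventually there are near-biaxial points `(1−η)λ₁(x) < λ₂(x)`; assembled for `q ≥ 2` as
  **`killing_shape_of_not_coercivePos_of_two_le`** (four limits + the gap exit).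

MEANING FOR (F2) (records only). Any future kernel refutation of L-λ(q), at any real exponent
`q > 1`, carries a sequence of zero-mean divergence-free fields whose strain-active region fills
`T³`, whose `λ₁^{q/2}` has vanishing relative variance and whose weighted `λ₁`-gradient energy is
`o(Φ_q)` (and, `q ≥ 2`, with near-biaxial points against every gap `η`); every recorded construction
class violating one of these is not a refutation. NOT here: frame rules (R13), the gap exit below
`q = 2`, any verdict change — L-λ(q) OPEN for all real `q > 1`; no 𝒦₀ row, no A12 count, no T_LD
input. [ours]
FILING (prove seat g30, REQUEST #88): declarations byte-identical to the no-go seat's staged `TopEigHeatKillingShape.STAGING.lean` ddff3468e29d843d; this line is the only addition.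
-/

noncomputable section
open MeasureTheory Set Filter Topology Metric Function
open scoped NNReal ENNReal

namespace Summit.NavierStokesRegularity.FunctionalMining

open Literature.Analysis.FunctionSpaces Literature.Analysis.FunctionSpaces.Torus

namespace TopEig

namespace KillingShape

/-! ## § 1 Killing sequences ⟺ `¬ L-λ(q)` (real `q ≥ 1`) -/

section Characterisation

variable {q : ℝ}

/-- If L-λ(q) fails (`q ≥ 1`), every rate `c > 0` is beaten by a smooth divergence-free zero-mean
field with `Φ_q(v) > 0` and `heatDissipation Φ_q v < c · Φ_q(v)` (the heat sieve
`topEigHeatCoercive_zero` excludes `Φ_q(v) = 0`). [ours] -/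
theorem exists_lt_of_not_coercivePos (hq : 1 ≤ q) (h : ¬ TopEigHeatCoercivePos (d := Fin 3) q)
    {c : ℝ} (hc : 0 < c) :
    ∃ v : UnitAddTorus (Fin 3) → EuclideanSpace ℝ (Fin 3), Torus.IsSmooth v ∧ Torus.IsDivFree v ∧
      Torus.HasZeroMean v ∧ 0 < torusTopEigMoment q v ∧
      heatDissipation (torusTopEigMoment q) v < c * torusTopEigMoment q v := by
  by_contra hne
  push Not at hne
  refine h ⟨c, hc, ?_⟩
  intro hd v hv hdv hm
  rcases (torusTopEigMoment_nonneg q v).eq_or_lt with h0 | hpos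
  · rw [← h0, mul_zero]
    simpa using topEigHeatCoercive_zero hq hd v hv hdv hm
  · exact hne v hv hdv hm hpos

/-- **`¬ L-λ(q) ↔ ∃ killing sequence`** (`q ≥ 1`): smooth, divergence-free, zero-mean `v n` on `T³`
with `Φ_q(v n) > 0` and `heatDissipation Φ_q (v n) / Φ_q(v n) → 0`. [ours] -/
theorem not_coercivePos_iff_exists_seq (hq : 1 ≤ q) :
    ¬ TopEigHeatCoercivePos (d := Fin 3) q ↔
      ∃ v : ℕ → UnitAddTorus (Fin 3) → EuclideanSpace ℝ (Fin 3),
        (∀ n, Torus.IsSmooth (v n) ∧ Torus.IsDivFree (v n) ∧ Torus.HasZeroMean (v n) ∧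
          0 < torusTopEigMoment q (v n)) ∧
        Tendsto (fun n => heatDissipation (torusTopEigMoment q) (v n) / torusTopEigMoment q (v n))
          atTop (𝓝 0) := by
  constructor
  · intro h
    have hc : ∀ n : ℕ, (0 : ℝ) < 1 / ((n : ℝ) + 1) := fun n => Nat.one_div_pos_of_nat
    choose v hv hdv hm hΦ hlt using fun n => exists_lt_of_not_coercivePos hq h (hc n)
    refine ⟨v, fun n => ⟨hv n, hdv n, hm n, hΦ n⟩, ?_⟩
    refine squeeze_zero (fun n => div_nonneg ?_ (hΦ n).le) (fun n => ?_)
      tendsto_one_div_add_atTop_nhds_zero_nat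
    · simpa using topEigHeatCoercive_zero hq (by simp) (v n) (hv n) (hdv n) (hm n)
    · rw [div_le_iff₀ (hΦ n)]
      exact (hlt n).le
  · rintro ⟨v, hv, hlim⟩ ⟨c, hc, hcoe⟩
    have hle : ∀ n, c ≤ heatDissipation (torusTopEigMoment q) (v n) / torusTopEigMoment q (v n) :=
      fun n => by
        rw [le_div_iff₀ (hv n).2.2.2]
        exact hcoe (by simp) (v n) (hv n).1 (hv n).2.1 (hv n).2.2.1
    have h0 : c ≤ 0 := ge_of_tendsto' hlim hle
    linarith

/-- The same on the constant: **`C_λ(q) = 0 ↔ ∃ killing sequence`** (`q ≥ 1`; tree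
`not_topEigHeatCoercivePos_iff_rate_eq_zero`). [ours, bookkeeping] -/
theorem topEigHeatRate_eq_zero_iff_exists_seq (hq : 1 ≤ q) :
    topEigHeatRate q = 0 ↔
      ∃ v : ℕ → UnitAddTorus (Fin 3) → EuclideanSpace ℝ (Fin 3),
        (∀ n, Torus.IsSmooth (v n) ∧ Torus.IsDivFree (v n) ∧ Torus.HasZeroMean (v n) ∧
          0 < torusTopEigMoment q (v n)) ∧
        Tendsto (fun n => heatDissipation (torusTopEigMoment q) (v n) / torusTopEigMoment q (v n))
          atTop (𝓝 0) :=
  (not_topEigHeatCoercivePos_iff_rate_eq_zero hq).symm.trans (not_coercivePos_iff_exists_seq hq)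

end Characterisation

/-! ## § 2 (R12′) NO CONCENTRATION for every real `q > 1` on `T³` -/

section NoConcentration

variable {v : UnitAddTorus (Fin 3) → EuclideanSpace ℝ (Fin 3)} {q : ℝ}

/-- **NO CONCENTRATION, every real `q > 1`.** `v` smooth divergence-free on `T³`, `λ₁ ≤ 0` off a
measurable set `A`: `16π²(q−1)/q · (1 − vol A) · Φ_q(v) ≤ heatDissipation Φ_q v` (K58ʼs
`VarianceLow.rate_moments_le_heatDissipation_of_one_lt` + K53cʼs Cauchy–Schwarz
`Variance.sq_topEigMoment_half_le_measureReal_mul`; K53c has it for `q ≥ 2`). [ours] -/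
theorem one_sub_measureReal_mul_moment_le_heatDissipation_of_one_lt (hq : 1 < q)
    (hv : Torus.IsSmooth v) (hdv : Torus.IsDivFree v) {A : Set (UnitAddTorus (Fin 3))}
    (hA : MeasurableSet A) (hAv : ∀ x, x ∉ A → torusStrainTopEig v x ≤ 0) :
    16 * Real.pi ^ 2 * (q - 1) / q * (1 - volume.real A) * torusTopEigMoment q v ≤
      heatDissipation (torusTopEigMoment q) v := by
  have h1 := VarianceLow.rate_moments_le_heatDissipation_of_one_lt hq hv hdv
  have hq0 : 0 < q := by linarith
  have h2 := Variance.sq_topEigMoment_half_le_measureReal_mul hv hq0 hA hAv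
  have hq1 : 0 ≤ q - 1 := by linarith
  have hc : 0 ≤ 16 * Real.pi ^ 2 * (q - 1) / q :=
    div_nonneg (mul_nonneg (by positivity) hq1) hq0.le
  calc 16 * Real.pi ^ 2 * (q - 1) / q * (1 - volume.real A) * torusTopEigMoment q v
      = 16 * Real.pi ^ 2 * (q - 1) / q *
          (torusTopEigMoment q v - volume.real A * torusTopEigMoment q v) := by ring
    _ ≤ 16 * Real.pi ^ 2 * (q - 1) / q *
          (torusTopEigMoment q v - torusTopEigMoment (q / 2) v ^ 2) :=
        mul_le_mul_of_nonneg_left (by linarith) hc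
    _ ≤ heatDissipation (torusTopEigMoment q) v := h1

/-- With `A = {λ₁ > 0}`, every real `q > 1`:
`16π²(q−1)/q · (1 − vol{λ₁ > 0}) · Φ_q(v) ≤ heatDissipation Φ_q v`. [ours] -/
theorem one_sub_measureReal_pos_mul_moment_le_heatDissipation_of_one_lt (hq : 1 < q)
    (hv : Torus.IsSmooth v) (hdv : Torus.IsDivFree v) :
    16 * Real.pi ^ 2 * (q - 1) / q * (1 - volume.real {x | 0 < torusStrainTopEig v x}) *
        torusTopEigMoment q v ≤
      heatDissipation (torusTopEigMoment q) v :=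
  one_sub_measureReal_mul_moment_le_heatDissipation_of_one_lt hq hv hdv
    (measurableSet_lt measurable_const (continuous_torusStrainTopEig hv).measurable)
    fun _ hx => not_lt.1 hx

/-- **Uniform price on sparse designs, every real `q > 1`.** `vol{λ₁ > 0} ≤ θ` gives
`16π²(q−1)/q · (1 − θ) · Φ_q(v) ≤ heatDissipation Φ_q v`. [ours] -/
theorem sparse_price_le_heatDissipation_of_one_lt (hq : 1 < q) (hv : Torus.IsSmooth v)
    (hdv : Torus.IsDivFree v) {θ : ℝ}
    (hθ : volume.real {x | 0 < torusStrainTopEig v x} ≤ θ) :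
    16 * Real.pi ^ 2 * (q - 1) / q * (1 - θ) * torusTopEigMoment q v ≤
      heatDissipation (torusTopEigMoment q) v := by
  have h := one_sub_measureReal_pos_mul_moment_le_heatDissipation_of_one_lt hq hv hdv
  have hq1 : 0 ≤ q - 1 := by linarith
  have hc : 0 ≤ 16 * Real.pi ^ 2 * (q - 1) / q :=
    div_nonneg (mul_nonneg (by positivity) hq1) (by linarith)
  calc 16 * Real.pi ^ 2 * (q - 1) / q * (1 - θ) * torusTopEigMoment q v
      ≤ 16 * Real.pi ^ 2 * (q - 1) / q * (1 - volume.real {x | 0 < torusStrainTopEig v x}) *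
          torusTopEigMoment q v :=
        mul_le_mul_of_nonneg_right (mul_le_mul_of_nonneg_left (by linarith) hc)
          (torusTopEigMoment_nonneg q v)
    _ ≤ heatDissipation (torusTopEigMoment q) v := h

/-- **(R12′) FILLING BOUND, every real `q > 1`.** `Φ_q(v) > 0`:
`1 − q/(16π²(q−1)) · heatDissipation Φ_q v / Φ_q(v) ≤ vol{λ₁ > 0}`. [ours] -/
theorem one_sub_ratio_le_measureReal_pos_of_one_lt (hq : 1 < q) (hv : Torus.IsSmooth v)
    (hdv : Torus.IsDivFree v) (hΦ : 0 < torusTopEigMoment q v) :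
    1 - q / (16 * Real.pi ^ 2 * (q - 1)) *
        (heatDissipation (torusTopEigMoment q) v / torusTopEigMoment q v) ≤
      volume.real {x | 0 < torusStrainTopEig v x} := by
  have h := one_sub_measureReal_pos_mul_moment_le_heatDissipation_of_one_lt hq hv hdv
  have hq0 : q ≠ 0 := by positivity
  have hq1 : 0 < q - 1 := by linarith
  have hπ : Real.pi ≠ 0 := Real.pi_ne_zero
  have hc : 0 < 16 * Real.pi ^ 2 * (q - 1) / q := by positivity
  have h' : 1 - volume.real {x | 0 < torusStrainTopEig v x} ≤
      heatDissipation (torusTopEigMoment q) v /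
        (16 * Real.pi ^ 2 * (q - 1) / q * torusTopEigMoment q v) := by
    rw [le_div_iff₀ (mul_pos hc hΦ)]
    calc (1 - volume.real {x | 0 < torusStrainTopEig v x}) *
          (16 * Real.pi ^ 2 * (q - 1) / q * torusTopEigMoment q v)
        = 16 * Real.pi ^ 2 * (q - 1) / q * (1 - volume.real {x | 0 < torusStrainTopEig v x}) *
            torusTopEigMoment q v := by ring
      _ ≤ heatDissipation (torusTopEigMoment q) v := h
  have e : heatDissipation (torusTopEigMoment q) v /
        (16 * Real.pi ^ 2 * (q - 1) / q * torusTopEigMoment q v) =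
      q / (16 * Real.pi ^ 2 * (q - 1)) *
        (heatDissipation (torusTopEigMoment q) v / torusTopEigMoment q v) := by
    field_simp
  linarith [h', e]

/-- `Φ_{q/2}(v)² ≤ Φ_q(v)` on the probability space `T³` (`q > 0`, `v` smooth): K53cʼs
Cauchy–Schwarz with `A = univ`. [ours] -/
theorem sq_topEigMoment_half_le (hq : 0 < q) (hv : Torus.IsSmooth v) :
    torusTopEigMoment (q / 2) v ^ 2 ≤ torusTopEigMoment q v := by
  have h := Variance.sq_topEigMoment_half_le_measureReal_mul hv hq MeasurableSet.univ
    fun x hx => absurd (mem_univ x) hx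
  simpa using h

end NoConcentration

/-! ## § 3 The shape of a killing sequence (every real `q > 1`, `T³`) -/

section Shape

variable {q : ℝ} {v : ℕ → UnitAddTorus (Fin 3) → EuclideanSpace ℝ (Fin 3)}

/-- **A killing sequence FILLS the torus** (every real `q > 1`): `vol{λ₁(v n) > 0} → 1`. [ours] -/
theorem tendsto_measureReal_pos_of_killing (hq : 1 < q) (hv : ∀ n, Torus.IsSmooth (v n))
    (hdv : ∀ n, Torus.IsDivFree (v n)) (hΦ : ∀ n, 0 < torusTopEigMoment q (v n))
    (hkill : Tendsto
      (fun n => heatDissipation (torusTopEigMoment q) (v n) / torusTopEigMoment q (v n))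
      atTop (𝓝 0)) :
    Tendsto (fun n => volume.real {x | 0 < torusStrainTopEig (v n) x}) atTop (𝓝 1) := by
  have hlim : Tendsto (fun n => 1 - q / (16 * Real.pi ^ 2 * (q - 1)) *
      (heatDissipation (torusTopEigMoment q) (v n) / torusTopEigMoment q (v n))) atTop (𝓝 1) := by
    simpa using (hkill.const_mul (q / (16 * Real.pi ^ 2 * (q - 1)))).const_sub 1
  exact tendsto_of_tendsto_of_tendsto_of_le_of_le hlim tendsto_const_nhds
    (fun n => one_sub_ratio_le_measureReal_pos_of_one_lt hq (hv n) (hdv n) (hΦ n))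
    fun n => measureReal_le_one

/-- **A killing sequence FLATTENS** (every real `q > 1`): `Φ_{q/2}(v n)² / Φ_q(v n) → 1` (K58ʼs
ratio form of (R12) below, `sq_topEigMoment_half_le` above). [ours] -/
theorem tendsto_moment_ratio_of_killing (hq : 1 < q) (hv : ∀ n, Torus.IsSmooth (v n))
    (hdv : ∀ n, Torus.IsDivFree (v n)) (hΦ : ∀ n, 0 < torusTopEigMoment q (v n))
    (hkill : Tendsto
      (fun n => heatDissipation (torusTopEigMoment q) (v n) / torusTopEigMoment q (v n))
      atTop (𝓝 0)) :
    Tendsto (fun n => torusTopEigMoment (q / 2) (v n) ^ 2 / torusTopEigMoment q (v n))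
      atTop (𝓝 1) := by
  have hlim : Tendsto (fun n => 1 - q / (16 * Real.pi ^ 2 * (q - 1)) *
      (heatDissipation (torusTopEigMoment q) (v n) / torusTopEigMoment q (v n))) atTop (𝓝 1) := by
    simpa using (hkill.const_mul (q / (16 * Real.pi ^ 2 * (q - 1)))).const_sub 1
  refine tendsto_of_tendsto_of_tendsto_of_le_of_le hlim tendsto_const_nhds (fun n => ?_) fun n => ?_
  · have h := VarianceLow.moment_ratio_deficit_le_of_one_lt hq (hv n) (hdv n) (hΦ n)
    linarith
  · rw [div_le_one (hΦ n)]
    exact sq_topEigMoment_half_le (by linarith) (hv n)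

/-- **A killing sequence is AMPLITUDE-FLAT** (every real `q > 1`):
`q(q−1)∫ λ₁^{q−2} Σᵢ(∂ᵢλ₁)² / Φ_q(v n) → 0` (K57aʼs LEMMA AF `topEigAmplitudeFloor_of_one_lt`).
[ours] -/
theorem tendsto_amplitude_div_of_killing (hq : 1 < q) (hv : ∀ n, Torus.IsSmooth (v n))
    (hdv : ∀ n, Torus.IsDivFree (v n)) (hΦ : ∀ n, 0 < torusTopEigMoment q (v n))
    (hkill : Tendsto
      (fun n => heatDissipation (torusTopEigMoment q) (v n) / torusTopEigMoment q (v n))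
      atTop (𝓝 0)) :
    Tendsto (fun n => (q * (q - 1) * ∫ x, torusStrainTopEig (v n) x ^ (q - 2) *
        ∑ i, (Torus.partialDeriv i (fun y => torusStrainTopEig (v n) y) x) ^ 2) /
      torusTopEigMoment q (v n)) atTop (𝓝 0) := by
  have hAF := topEigAmplitudeFloor_of_one_lt (d := Fin 3) hq
  have hnn : ∀ n, 0 ≤ q * (q - 1) * ∫ x, torusStrainTopEig (v n) x ^ (q - 2) *
      ∑ i, (Torus.partialDeriv i (fun y => torusStrainTopEig (v n) y) x) ^ 2 := fun n => by
    have hLnn : ∀ y, 0 ≤ torusStrainTopEig (v n) y := fun y => by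
      rw [← lam_strainFlat]; exact lam_strainFlat_nonneg (hv n) (hdv n) y
    refine mul_nonneg (mul_nonneg (by linarith) (by linarith)) (integral_nonneg fun x => ?_)
    exact mul_nonneg (Real.rpow_nonneg (hLnn x) _) (Finset.sum_nonneg fun i _ => sq_nonneg _)
  refine squeeze_zero (fun n => div_nonneg (hnn n) (hΦ n).le) (fun n => ?_) hkill
  exact div_le_div_of_nonneg_right (hAF (by simp) (v n) (hv n) (hdv n)) (hΦ n).le

/-- **THE SHAPE OF A KILL (every real `q > 1`).** If Lemma L-λ(q) fails in the kernel, there is a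
sequence of smooth, divergence-free, zero-mean fields `v n` on `T³` with `Φ_q(v n) > 0`,
`heatDissipation Φ_q (v n) / Φ_q(v n) → 0`, `vol{λ₁(v n) > 0} → 1` (fills),
`Φ_{q/2}(v n)² / Φ_q(v n) → 1` (flattens) and `q(q−1)∫λ₁^{q−2}Σᵢ(∂ᵢλ₁)² / Φ_q(v n) → 0`
(amplitude-flat). No node decided: the hypothesis is the OPEN negation. [ours] -/
theorem killing_shape_of_not_coercivePos (hq : 1 < q) (h : ¬ TopEigHeatCoercivePos (d := Fin 3) q) :
    ∃ v : ℕ → UnitAddTorus (Fin 3) → EuclideanSpace ℝ (Fin 3),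
      (∀ n, Torus.IsSmooth (v n) ∧ Torus.IsDivFree (v n) ∧ Torus.HasZeroMean (v n) ∧
        0 < torusTopEigMoment q (v n)) ∧
      Tendsto (fun n => heatDissipation (torusTopEigMoment q) (v n) / torusTopEigMoment q (v n))
        atTop (𝓝 0) ∧
      Tendsto (fun n => volume.real {x | 0 < torusStrainTopEig (v n) x}) atTop (𝓝 1) ∧
      Tendsto (fun n => torusTopEigMoment (q / 2) (v n) ^ 2 / torusTopEigMoment q (v n))
        atTop (𝓝 1) ∧
      Tendsto (fun n => (q * (q - 1) * ∫ x, torusStrainTopEig (v n) x ^ (q - 2) *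
          ∑ i, (Torus.partialDeriv i (fun y => torusStrainTopEig (v n) y) x) ^ 2) /
        torusTopEigMoment q (v n)) atTop (𝓝 0) := by
  obtain ⟨v, hv, hkill⟩ := (not_coercivePos_iff_exists_seq hq.le).1 h
  exact ⟨v, hv, hkill,
    tendsto_measureReal_pos_of_killing hq (fun n => (hv n).1) (fun n => (hv n).2.1)
      (fun n => (hv n).2.2.2) hkill,
    tendsto_moment_ratio_of_killing hq (fun n => (hv n).1) (fun n => (hv n).2.1)
      (fun n => (hv n).2.2.2) hkill,
    tendsto_amplitude_div_of_killing hq (fun n => (hv n).1) (fun n => (hv n).2.1)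
      (fun n => (hv n).2.2.2) hkill⟩

end Shape

/-! ## § 4 Near-biaxial exit: a killing sequence leaves every top-gap class (real `q ≥ 2`, `T³`) -/

section GapExit

variable {q : ℝ} {v : ℕ → UnitAddTorus (Fin 3) → EuclideanSpace ℝ (Fin 3)}

/-- **A killing sequence is eventually OUTSIDE every top-gap class** (real `q ≥ 2`, `η > 0`;
zero-mean members): Proposition L-λ(η) (tree `topEigGapCoercivePos_of_ge_two`) prices the class
`λ₂ ≤ (1−η)λ₁` at a rate `c(q, η) > 0`, and the ratio is eventually below it. [ours; sequential form
of the treeʼs `violators_outside_every_gap_of_not_pos_of_ge_two`] -/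
theorem eventually_not_strainGapClass_of_killing (hq : 2 ≤ q) {η : ℝ} (hη : 0 < η)
    (hv : ∀ n, Torus.IsSmooth (v n)) (hdv : ∀ n, Torus.IsDivFree (v n))
    (hm : ∀ n, Torus.HasZeroMean (v n)) (hΦ : ∀ n, 0 < torusTopEigMoment q (v n))
    (hkill : Tendsto
      (fun n => heatDissipation (torusTopEigMoment q) (v n) / torusTopEigMoment q (v n))
      atTop (𝓝 0)) :
    ∀ᶠ n in atTop, ¬ StrainGapClass η (v n) := by
  obtain ⟨c, hc, hcoe⟩ := topEigGapCoercivePos_of_ge_two hq hη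
  filter_upwards [(tendsto_order.1 hkill).2 c hc] with n hn hcls
  exact (not_le.2 hn) ((le_div_iff₀ (hΦ n)).2 (hcoe (by simp) (v n) (hv n) (hdv n) (hm n) hcls))

/-- Pointwise reading: eventually every member has a NEAR-BIAXIAL point `(1−η)·λ₁(x) < λ₂(x)`
(real `q ≥ 2`, every `η > 0`). [ours] -/
theorem eventually_exists_nearBiaxial_of_killing (hq : 2 ≤ q) {η : ℝ} (hη : 0 < η)
    (hv : ∀ n, Torus.IsSmooth (v n)) (hdv : ∀ n, Torus.IsDivFree (v n))
    (hm : ∀ n, Torus.HasZeroMean (v n)) (hΦ : ∀ n, 0 < torusTopEigMoment q (v n))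
    (hkill : Tendsto
      (fun n => heatDissipation (torusTopEigMoment q) (v n) / torusTopEigMoment q (v n))
      atTop (𝓝 0)) :
    ∀ᶠ n in atTop, ∃ x, (1 - η) * torusStrainTopEig (v n) x < torusStrainMidEig (v n) x := by
  filter_upwards [eventually_not_strainGapClass_of_killing hq hη hv hdv hm hΦ hkill] with n hn
  exact (not_strainGapClass_iff η (v n)).1 hn

/-- **THE SHAPE OF A KILL, real `q ≥ 2`:** the four limits of `killing_shape_of_not_coercivePos` AND
the near-biaxial exit against every gap `η > 0`. No node decided. [ours] -/
theorem killing_shape_of_not_coercivePos_of_two_le (hq : 2 ≤ q)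
    (h : ¬ TopEigHeatCoercivePos (d := Fin 3) q) :
    ∃ v : ℕ → UnitAddTorus (Fin 3) → EuclideanSpace ℝ (Fin 3),
      (∀ n, Torus.IsSmooth (v n) ∧ Torus.IsDivFree (v n) ∧ Torus.HasZeroMean (v n) ∧
        0 < torusTopEigMoment q (v n)) ∧
      Tendsto (fun n => heatDissipation (torusTopEigMoment q) (v n) / torusTopEigMoment q (v n))
        atTop (𝓝 0) ∧
      Tendsto (fun n => volume.real {x | 0 < torusStrainTopEig (v n) x}) atTop (𝓝 1) ∧
      Tendsto (fun n => torusTopEigMoment (q / 2) (v n) ^ 2 / torusTopEigMoment q (v n))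
        atTop (𝓝 1) ∧
      Tendsto (fun n => (q * (q - 1) * ∫ x, torusStrainTopEig (v n) x ^ (q - 2) *
          ∑ i, (Torus.partialDeriv i (fun y => torusStrainTopEig (v n) y) x) ^ 2) /
        torusTopEigMoment q (v n)) atTop (𝓝 0) ∧
      ∀ η : ℝ, 0 < η →
        ∀ᶠ n in atTop, ∃ x, (1 - η) * torusStrainTopEig (v n) x < torusStrainMidEig (v n) x := by
  obtain ⟨v, hv, hkill, hfill, hflat, hamp⟩ := killing_shape_of_not_coercivePos (by linarith) h
  exact ⟨v, hv, hkill, hfill, hflat, hamp, fun η hη =>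
    eventually_exists_nearBiaxial_of_killing hq hη (fun n => (hv n).1) (fun n => (hv n).2.1)
      (fun n => (hv n).2.2.1) (fun n => (hv n).2.2.2) hkill⟩

end GapExit

end KillingShape

end TopEig

end Summit.NavierStokesRegularity.FunctionalMining

end
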